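import Summits.BirchSwinnertonDyer.BirchSwinnertonDyer.Theorems.TwoAdicConverseTwoDivisionCubicDyadicType
import Literature.NumberTheory.EllipticCurves.LocalTorsionMultiplicativeProofs
import HarnessLib

/-!
# Route `TwoAdicConverse` (rung S3), crux `OrdLambdaHalfAtTwo` (item 19556), line L2 `f4-semisimple-cubic-two` §(1): at every
# ODD MULTIPLICATIVE prime `ℓ` the `2`-division cubic has a `ℚ_ℓ`-root (Tate's rational `2`-torsion point), and it has `3`
# roots in `ℚ_ℓ` iff `Δ` is an `ℓ`-adic square, `1` otherwise — so on the strata with `Δ ∈ ℚ×²` (cubic image (γ₁), full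
# `2`-torsion) EVERY multiplicative prime splits completely in `ℚ(E[2])`

Cell `bsd-2adic`, seat `bsd-2adic-conv-1` (GEN 22). THEOREMS ONLY — no named fact, no definition, nothing conditional, no `sorry`.
HONEST FRAMING: local algebra at the bad primes; nothing about `λ`-invariants, Selmer groups or `L`-values; items 19556 / 19218 stay
OPEN; BSD is not proved by any of this. PARTITION (D-0054): none — RANK axis (S3); types-the-object-of (card `f4-semisimple-cubic-two`
§«Why it bites here (1)»: «every multiplicative prime splits completely in K₃ (Tate curve: unipotent mod 2)»), in the tree's
Galois-representation-free vocabulary `((W.twoTorsionPolynomial.toPoly).map (algebraMap ℚ ℚ_[ℓ])).roots.card`.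

**Mechanism (elementary).** Let `W/ℚ` be globally minimal with MULTIPLICATIVE reduction at an odd prime `ℓ`: `ℓ ∣ Δ`, `ℓ ∤ c₄`
(tree `dvd_Δ_and_not_dvd_c₄_integralModelInt_of_mult`, Silverman VII.5.1(b)). The `2`-division cubic
`ψ₂² = 4x³ + b₂x² + 2b₄x + b₆` reduces mod `ℓ` to a NODAL cubic: a double root (the node) and a SIMPLE root. The simple root is
the explicit `ℓ`-integer `s = −(b₂³ − 32b₂b₄ + 144b₆)/(4c₄)`, for which the exact identities
`c₄³·ψ₂²(s) = −32·Δ·c₆` and `4c₄²·ψ₂²′(s) = c₄³ − 2304·Δ` hold (§1, any field; polynomial identities modulo the `b`-relation).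
Hence `‖ψ₂²(s)‖_ℓ ≤ ‖Δ‖_ℓ < 1 = ‖ψ₂²′(s)‖_ℓ` and HENSEL (`hensels_lemma`) produces a root `x₀ ∈ ℤ_ℓ` (§2) — the abscissa of the
`ℚ_ℓ`-rational `2`-torsion point of the Tate curve (`−1 ∈ μ₂ ⊂ ℚ_ℓ×/q^ℤ`; the same for its unramified twist). Given ONE root over a
field `K ⊇ ℚ`, the quadratic cofactor has discriminant `16Δ/ψ₂²′(x₀)²` (GEN 21 `sixteen_mul_Δ_eq_of_root`), so `ψ₂²` has `3` roots in
`K` iff `Δ ∈ K×²` and exactly `1` otherwise (§1, the field-generic form of GEN 21's dyadic dichotomy p639351); at `K = ℚ_ℓ` (§3):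

* `exists_padic_root_twoDivisionCubic_of_mult_odd` — `Mult W ℓ`, `ℓ ≠ 2` ⇒ `∃ x ∈ ℚ_ℓ, ψ₂²(x) = 0`;
* `card_roots_twoTorsionPolynomial_padic_eq_three_iff_of_mult_odd` — `roots.card = 3 ⟺ IsSquare (Δ : ℚ_ℓ)`, else `= 1`
  (`…_eq_one_or_three_of_mult_odd`);
* `card_roots_twoTorsionPolynomial_padic_eq_three_of_mult_of_isSquare` — for `Δ_W ∈ ℚ×²` and ANY multiplicative prime `ℓ`
  (odd here, `ℓ = 2` by GEN 21 `…_padic_two_of_goodOrd_or_mult_of_isSquare`): `E[2] ⊂ E(ℚ_ℓ)`.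

References: J. H. Silverman, *AEC* (2009), VII.5 Prop. 5.1(b), C.14 (Tate curve), III.1; K. Conrad / Mathlib `hensels_lemma`.
[SilvermanAEC2009]
-/

set_option linter.dupNamespace false
set_option autoImplicit false

noncomputable section

open scoped Classical
open Polynomial WeierstrassCurve Literature.NumberTheory.EllipticCurves Literature.NumberTheory.EllipticCurves.Greenberg1999
  Literature.NumberTheory.EllipticCurves.Rank1Residual

namespace Summit.BirchSwinnertonDyer.BirchSwinnertonDyer.Theorems.TwoAdicTwistConverse

variable (W : WeierstrassCurve ℚ) [W.IsElliptic] [W.IsGloballyMinimal]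

/-! ## §1. Field-generic algebra: the simple root of a nodal `2`-division cubic, and the `1`/`3` dichotomy given one root -/

omit [W.IsElliptic] [W.IsGloballyMinimal] in
/-- **The node's companion root.** In any field `K ⊇ ℚ`, with `n := −(b₂³ − 32b₂b₄ + 144b₆)` one has
`n³ + b₂c₄n² + 8b₄c₄²n + 16b₆c₄³ = −512·Δ·c₆`, i.e. `c₄³·ψ₂²(n/(4c₄)) = −32·Δ·c₆` whenever `c₄ ≠ 0`
(a polynomial identity modulo the `b`-relation `4b₈ = b₂b₆ − b₄²`). [folklore] -/
theorem twoDivisionCubic_node_companion_identity {K : Type*} [Field K] [CharZero K] :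
    let n : K := -((W.b₂ : K) ^ 3 - 32 * (W.b₂ : K) * W.b₄ + 144 * W.b₆)
    n ^ 3 + (W.b₂ : K) * W.c₄ * n ^ 2 + 8 * (W.b₄ : K) * (W.c₄ : K) ^ 2 * n + 16 * (W.b₆ : K) * (W.c₄ : K) ^ 3 =
      -512 * (W.Δ : K) * W.c₆ := by
  intro n
  have key : (-(W.b₂ ^ 3 - 32 * W.b₂ * W.b₄ + 144 * W.b₆)) ^ 3 +
      W.b₂ * W.c₄ * (-(W.b₂ ^ 3 - 32 * W.b₂ * W.b₄ + 144 * W.b₆)) ^ 2 +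
      8 * W.b₄ * W.c₄ ^ 2 * (-(W.b₂ ^ 3 - 32 * W.b₂ * W.b₄ + 144 * W.b₆)) + 16 * W.b₆ * W.c₄ ^ 3 =
      -512 * W.Δ * W.c₆ := by
    simp only [WeierstrassCurve.Δ, WeierstrassCurve.c₄, WeierstrassCurve.c₆]
    linear_combination (-128 * W.b₂ ^ 2 * (-W.b₂ ^ 3 + 36 * W.b₂ * W.b₄ - 216 * W.b₆)) * W.b_relation
  have := congrArg (fun q : ℚ ↦ (q : K)) key
  push_cast at this
  simpa [n] using this

omit [W.IsElliptic] [W.IsGloballyMinimal] in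
/-- **The derivative at the companion root**: `3n² + 2b₂c₄n + 8b₄c₄² = c₄³ − 2304·Δ`, i.e. `4c₄²·ψ₂²′(n/(4c₄)) = c₄³ − 2304Δ`.
[folklore] -/
theorem twoDivisionCubic_node_companion_derivative_identity {K : Type*} [Field K] [CharZero K] :
    let n : K := -((W.b₂ : K) ^ 3 - 32 * (W.b₂ : K) * W.b₄ + 144 * W.b₆)
    3 * n ^ 2 + 2 * (W.b₂ : K) * W.c₄ * n + 8 * (W.b₄ : K) * (W.c₄ : K) ^ 2 = (W.c₄ : K) ^ 3 - 2304 * (W.Δ : K) := by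
  intro n
  have key : 3 * (-(W.b₂ ^ 3 - 32 * W.b₂ * W.b₄ + 144 * W.b₆)) ^ 2 +
      2 * W.b₂ * W.c₄ * (-(W.b₂ ^ 3 - 32 * W.b₂ * W.b₄ + 144 * W.b₆)) + 8 * W.b₄ * W.c₄ ^ 2 =
      W.c₄ ^ 3 - 2304 * W.Δ := by
    simp only [WeierstrassCurve.Δ, WeierstrassCurve.c₄]
    linear_combination (-576 * W.b₂ ^ 2) * W.b_relation
  have := congrArg (fun q : ℚ ↦ (q : K)) key
  push_cast at this
  simpa [n] using this

omit [W.IsGloballyMinimal] in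
/-- **Three roots from one root and a square discriminant** (any field `K ⊇ ℚ`): if `ψ₂²(r) = 0` for some `r ∈ K` and `Δ_W` is a
square in `K`, then `ψ₂²` has `3` roots in `K` — the quadratic cofactor has discriminant `16Δ/ψ₂²′(r)²`
(`sixteen_mul_Δ_eq_of_root`). Field-generic form of GEN 21's `card_roots_twoTorsionPolynomial_padic_two`. [folklore] -/
theorem card_roots_twoTorsionPolynomial_eq_three_of_root_of_isSquare {K : Type*} [Field K] [CharZero K] {r : K}
    (hr : 4 * r ^ 3 + (W.b₂ : K) * r ^ 2 + 2 * (W.b₄ : K) * r + (W.b₆ : K) = 0) (hΔ : IsSquare ((W.Δ : ℚ) : K)) :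
    Multiset.card ((W.twoTorsionPolynomial.toPoly).map (algebraMap ℚ K)).roots = 3 := by
  obtain ⟨w, hw⟩ := hΔ
  set p : K := (W.b₂ : K) with hp
  set q : K := (W.b₄ : K) with hq
  set s : K := (W.b₆ : K) with hs
  have hkey : ((4 * r + p) ^ 2 - 16 * (4 * r ^ 2 + p * r + 2 * q)) * (12 * r ^ 2 + 2 * p * r + 2 * q) ^ 2 =
      16 * ((W.Δ : ℚ) : K) := by
    have := sixteen_mul_Δ_eq_of_root W hr
    simpa using this
  have hΔ0 : ((W.Δ : ℚ) : K) ≠ 0 := by exact_mod_cast W.isUnit_Δ.ne_zero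
  have hG0 : 12 * r ^ 2 + 2 * p * r + 2 * q ≠ 0 := by
    intro h0
    rw [h0, zero_pow two_ne_zero, mul_zero] at hkey
    exact hΔ0 (by linear_combination -hkey / 16)
  obtain ⟨sD, hsD2⟩ : ∃ sD : K, sD ^ 2 = (4 * r + p) ^ 2 - 16 * (4 * r ^ 2 + p * r + 2 * q) := by
    refine ⟨4 * w / (12 * r ^ 2 + 2 * p * r + 2 * q), ?_⟩
    rw [div_pow, div_eq_iff (pow_ne_zero _ hG0)]
    linear_combination -hkey - 16 * hw
  set r₂ : K := (-(4 * r + p) + sD) / 8 with hr₂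
  set r₃ : K := (-(4 * r + p) - sD) / 8 with hr₃
  have hpoly : (W.twoTorsionPolynomial.toPoly).map (algebraMap ℚ K) =
      C (4 : K) * (X - C r) * (X - C r₂) * (X - C r₃) := by
    rw [Cubic.C_mul_prod_X_sub_C_eq, ← Cubic.map_toPoly]
    congr 1
    simp only [Cubic.map, WeierstrassCurve.twoTorsionPolynomial, eq_ratCast]
    ext
    · norm_num
    · show (W.b₂ : K) = 4 * -(r + r₂ + r₃)
      rw [hr₂, hr₃, ← hp]; ring
    · show ((2 * W.b₄ : ℚ) : K) = 4 * (r * r₂ + r * r₃ + r₂ * r₃)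
      push_cast
      rw [← hq, hr₂, hr₃]
      linear_combination (1 / 16 : K) * hsD2
    · show (W.b₆ : K) = 4 * -(r * r₂ * r₃)
      rw [← hs, hr₂, hr₃]
      linear_combination hr - (r / 16) * hsD2
  rw [hpoly, roots_mul, roots_mul, roots_C_mul _ (by norm_num), roots_X_sub_C, roots_X_sub_C, roots_X_sub_C]
  · rfl
  · exact mul_ne_zero (mul_ne_zero (C_ne_zero.mpr (by norm_num)) (X_sub_C_ne_zero r)) (X_sub_C_ne_zero r₂)
  · exact mul_ne_zero (mul_ne_zero (mul_ne_zero (C_ne_zero.mpr (by norm_num)) (X_sub_C_ne_zero r))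
      (X_sub_C_ne_zero r₂)) (X_sub_C_ne_zero r₃)

omit [W.IsElliptic] [W.IsGloballyMinimal] in
/-- **Exactly one root from one root and a non-square discriminant** (any field `K ⊇ ℚ`): if `ψ₂²(r) = 0` for some `r ∈ K` and
`Δ_W` is NOT a square in `K`, the quadratic cofactor has no root in `K`, so `ψ₂²` has exactly `1` root in `K`. Field-generic form
of GEN 21's `card_roots_twoTorsionPolynomial_padic_two_eq_one`. [folklore] -/
theorem card_roots_twoTorsionPolynomial_eq_one_of_root_of_not_isSquare {K : Type*} [Field K] [CharZero K] {r : K}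
    (hr : 4 * r ^ 3 + (W.b₂ : K) * r ^ 2 + 2 * (W.b₄ : K) * r + (W.b₆ : K) = 0) (hΔ : ¬ IsSquare ((W.Δ : ℚ) : K)) :
    Multiset.card ((W.twoTorsionPolynomial.toPoly).map (algebraMap ℚ K)).roots = 1 := by
  set p : K := (W.b₂ : K) with hp
  set q : K := (W.b₄ : K) with hq
  have hkey : ((4 * r + p) ^ 2 - 16 * (4 * r ^ 2 + p * r + 2 * q)) * (12 * r ^ 2 + 2 * p * r + 2 * q) ^ 2 =
      16 * ((W.Δ : ℚ) : K) := by
    have := sixteen_mul_Δ_eq_of_root W hr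
    simpa using this
  set g : K[X] := C 4 * X ^ 2 + C (4 * r + p) * X + C (4 * r ^ 2 + p * r + 2 * q) with hg
  have hdisc : ∀ t : K, discrim 4 (4 * r + p) (4 * r ^ 2 + p * r + 2 * q) ≠ t ^ 2 := by
    intro t ht
    apply hΔ
    refine ⟨t * (12 * r ^ 2 + 2 * p * r + 2 * q) / 4, ?_⟩
    rw [discrim] at ht
    linear_combination (-1 / 16 : K) * hkey + ((12 * r ^ 2 + 2 * p * r + 2 * q) ^ 2 / 16) * ht
  have hgeval : ∀ t : K, g.eval t = 4 * (t * t) + (4 * r + p) * t + (4 * r ^ 2 + p * r + 2 * q) := by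
    intro t
    simp only [hg, eval_add, eval_mul, eval_C, eval_pow, eval_X]
    ring
  have hg0 : g ≠ 0 := by
    intro h0
    have h := hgeval 0
    rw [h0, eval_zero] at h
    exact quadratic_ne_zero_of_discrim_ne_sq hdisc 0 h.symm
  have hgroots : g.roots = 0 := by
    refine Multiset.eq_zero_of_forall_notMem fun t ht ↦ ?_
    rw [mem_roots hg0, IsRoot.def, hgeval] at ht
    exact quadratic_ne_zero_of_discrim_ne_sq hdisc t ht
  have hXr : (X - C r) * g ≠ 0 := mul_ne_zero (X_sub_C_ne_zero r) hg0
  rw [map_twoTorsionPolynomial_eq_mul_of_root W hr, ← hg, roots_mul hXr, roots_X_sub_C, hgroots]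
  rfl

omit [W.IsGloballyMinimal] in
/-- **The `1`/`3` dichotomy given one root** (any field `K ⊇ ℚ`): `roots.card = 3 ⟺ Δ_W ∈ K×²`. [folklore] -/
theorem card_roots_twoTorsionPolynomial_eq_three_iff_of_root {K : Type*} [Field K] [CharZero K] {r : K}
    (hr : 4 * r ^ 3 + (W.b₂ : K) * r ^ 2 + 2 * (W.b₄ : K) * r + (W.b₆ : K) = 0) :
    Multiset.card ((W.twoTorsionPolynomial.toPoly).map (algebraMap ℚ K)).roots = 3 ↔ IsSquare ((W.Δ : ℚ) : K) := by
  refine ⟨fun h3 ↦ ?_, card_roots_twoTorsionPolynomial_eq_three_of_root_of_isSquare W hr⟩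
  by_contra hΔ
  have h1 := card_roots_twoTorsionPolynomial_eq_one_of_root_of_not_isSquare W hr hΔ
  omega

/-! ## §2. Hensel at an odd multiplicative prime -/

omit [W.IsElliptic] in
/-- `c₄(W) = c₄(E₀)` and `c₆(W) = c₆(E₀)` in `ℚ` for the integral model `E₀ = integralModelInt W`. [folklore] -/
theorem c₄_c₆_eq_intCast :
    W.c₄ = ((integralModelInt W).c₄ : ℚ) ∧ W.c₆ = ((integralModelInt W).c₆ : ℚ) := by
  have h₄ := (integralModelInt W).map_c₄ (Int.castRingHom ℚ)
  have h₆ := (integralModelInt W).map_c₆ (Int.castRingHom ℚ)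
  rw [map_integralModelInt, eq_intCast] at h₄ h₆
  exact ⟨h₄, h₆⟩

/-- **Tate's rational `2`-torsion point: at an ODD MULTIPLICATIVE prime `ℓ` the `2`-division cubic has a root in `ℚ_ℓ`.** With
`s = −(b₂³ − 32b₂b₄ + 144b₆)/(4c₄) ∈ ℤ_ℓ` (`ℓ ∤ 4c₄`): `‖ψ₂²(s)‖ = ‖32Δc₆/c₄³‖ ≤ ‖Δ‖ < 1` and
`‖ψ₂²′(s)‖ = ‖c₄/4 − 576Δ/c₄²‖ = 1`, so `hensels_lemma` gives a root near `s`.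
[cite: SilvermanAEC2009, VII.5 Prop. 5.1(b) and C.14 (the Tate curve)] -/
theorem exists_padic_root_twoDivisionCubic_of_mult_odd {ℓ : ℕ} [Fact ℓ.Prime] (hℓ : ℓ ≠ 2) (hm : Mult W ℓ) :
    ∃ x : ℚ_[ℓ], 4 * x ^ 3 + (W.b₂ : ℚ_[ℓ]) * x ^ 2 + 2 * (W.b₄ : ℚ_[ℓ]) * x + (W.b₆ : ℚ_[ℓ]) = 0 := by
  obtain ⟨hΔE, hc₄E⟩ := LocalTorsionMult.dvd_Δ_and_not_dvd_c₄_integralModelInt_of_mult W ℓ hm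
  obtain ⟨hb₂, hb₄, hb₆⟩ := b₂_b₄_b₆_eq_intCast W
  obtain ⟨hc₄, hc₆⟩ := c₄_c₆_eq_intCast W
  have hΔQ : W.Δ = ((integralModelInt W).Δ : ℚ) := by
    rw [← cast_minimalDiscriminantInt W, minimalDiscriminantInt]
  set E := integralModelInt W with hE
  -- the data in `ℚ_ℓ`
  set B₂ : ℚ_[ℓ] := (E.b₂ : ℚ_[ℓ]) with hB₂
  set B₄ : ℚ_[ℓ] := (E.b₄ : ℚ_[ℓ]) with hB₄
  set B₆ : ℚ_[ℓ] := (E.b₆ : ℚ_[ℓ]) with hB₆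
  set c4 : ℚ_[ℓ] := (E.c₄ : ℚ_[ℓ]) with hc4
  set c6 : ℚ_[ℓ] := (E.c₆ : ℚ_[ℓ]) with hc6
  set Δ : ℚ_[ℓ] := (E.Δ : ℚ_[ℓ]) with hΔdef
  -- casts of `W`'s rational invariants into `ℚ_ℓ`
  have eb₂ : ((W.b₂ : ℚ) : ℚ_[ℓ]) = B₂ := by rw [hb₂]; push_cast; rfl
  have eb₄ : ((W.b₄ : ℚ) : ℚ_[ℓ]) = B₄ := by rw [hb₄]; push_cast; rfl
  have eb₆ : ((W.b₆ : ℚ) : ℚ_[ℓ]) = B₆ := by rw [hb₆]; push_cast; rfl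
  have ec₄ : ((W.c₄ : ℚ) : ℚ_[ℓ]) = c4 := by rw [hc₄]; push_cast; rfl
  have ec₆ : ((W.c₆ : ℚ) : ℚ_[ℓ]) = c6 := by rw [hc₆]; push_cast; rfl
  have eΔ : ((W.Δ : ℚ) : ℚ_[ℓ]) = Δ := by rw [hΔQ]; push_cast; rfl
  -- norms
  have hℓ4 : ¬ (ℓ : ℤ) ∣ 4 := by
    intro h
    have h' : (ℓ : ℤ) ∣ 2 ^ 2 := by simpa using h
    have := Int.Prime.dvd_pow' (Fact.out : ℓ.Prime) h'
    have h2 : (ℓ : ℤ) ∣ 2 := this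
    have : ℓ ∣ 2 := by exact_mod_cast h2
    exact hℓ ((Nat.prime_dvd_prime_iff_eq (Fact.out) Nat.prime_two).mp this)
  have n4 : ‖(4 : ℚ_[ℓ])‖ = 1 := by
    have h1 : ‖((4 : ℤ) : ℚ_[ℓ])‖ ≤ 1 := Padic.norm_int_le_one 4
    have h2 : ¬ ‖((4 : ℤ) : ℚ_[ℓ])‖ < 1 := fun h ↦ hℓ4 (Padic.norm_intCast_lt_one_iff.mp h)
    push_cast at h1 h2
    exact le_antisymm h1 (not_lt.mp h2)
  have nc4 : ‖c4‖ = 1 := by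
    have h1 : ‖c4‖ ≤ 1 := Padic.norm_int_le_one _
    have h2 : ¬ ‖c4‖ < 1 := fun h ↦ hc₄E (Padic.norm_intCast_lt_one_iff.mp h)
    exact le_antisymm h1 (not_lt.mp h2)
  have nΔ : ‖Δ‖ < 1 := Padic.norm_intCast_lt_one_iff.mpr hΔE
  have nc6 : ‖c6‖ ≤ 1 := Padic.norm_int_le_one _
  have nB₂ : ‖B₂‖ ≤ 1 := Padic.norm_int_le_one _
  have nB₄ : ‖B₄‖ ≤ 1 := Padic.norm_int_le_one _
  have nB₆ : ‖B₆‖ ≤ 1 := Padic.norm_int_le_one _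
  have hc40 : c4 ≠ 0 := fun h ↦ by rw [h, norm_zero] at nc4; exact zero_ne_one nc4
  have h40 : (4 : ℚ_[ℓ]) ≠ 0 := fun h ↦ by rw [h, norm_zero] at n4; exact zero_ne_one n4
  -- the companion root `s`
  set n : ℚ_[ℓ] := -(B₂ ^ 3 - 32 * B₂ * B₄ + 144 * B₆) with hn
  have nn : ‖n‖ ≤ 1 := by
    have : n = ((-(E.b₂ ^ 3 - 32 * E.b₂ * E.b₄ + 144 * E.b₆) : ℤ) : ℚ_[ℓ]) := by rw [hn]; push_cast; rfl
    rw [this]; exact Padic.norm_int_le_one _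
  set s : ℚ_[ℓ] := n / (4 * c4) with hsdef
  have ns : ‖s‖ ≤ 1 := by
    rw [hsdef, norm_div, norm_mul, n4, nc4, one_mul, div_one]; exact nn
  -- the two identities, read in `ℚ_ℓ` for the base change of `W`
  have I1 := twoDivisionCubic_node_companion_identity W (K := ℚ_[ℓ])
  have I2 := twoDivisionCubic_node_companion_derivative_identity W (K := ℚ_[ℓ])
  simp only [eb₂, eb₄, eb₆, ec₄, ec₆, eΔ] at I1 I2
  change n ^ 3 + B₂ * c4 * n ^ 2 + 8 * B₄ * c4 ^ 2 * n + 16 * B₆ * c4 ^ 3 = -512 * Δ * c6 at I1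
  change 3 * n ^ 2 + 2 * B₂ * c4 * n + 8 * B₄ * c4 ^ 2 = c4 ^ 3 - 2304 * Δ at I2
  have hFs : 4 * s ^ 3 + B₂ * s ^ 2 + 2 * B₄ * s + B₆ = -32 * Δ * c6 / c4 ^ 3 := by
    have e : 4 * s ^ 3 + B₂ * s ^ 2 + 2 * B₄ * s + B₆ =
        (n ^ 3 + B₂ * c4 * n ^ 2 + 8 * B₄ * c4 ^ 2 * n + 16 * B₆ * c4 ^ 3) / (16 * c4 ^ 3) := by
      rw [hsdef]; field_simp; ring
    rw [e, I1]; field_simp; ring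
  have hF's : 12 * s ^ 2 + 2 * B₂ * s + 2 * B₄ = c4 / 4 + -(576 * Δ / c4 ^ 2) := by
    have e : 12 * s ^ 2 + 2 * B₂ * s + 2 * B₄ =
        (3 * n ^ 2 + 2 * B₂ * c4 * n + 8 * B₄ * c4 ^ 2) / (4 * c4 ^ 2) := by
      rw [hsdef]; field_simp; ring
    rw [e, I2]; field_simp; ring
  -- Hensel (integer coefficients kept opaque, as in GEN 21's `exists_padicInt_root_of_odd`)
  obtain ⟨K₃, hK₃⟩ : ∃ t : ℤ, t = 4 := ⟨_, rfl⟩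
  obtain ⟨K₁, hK₁⟩ : ∃ t : ℤ, t = 2 * E.b₄ := ⟨_, rfl⟩
  obtain ⟨K₃', hK₃'⟩ : ∃ t : ℤ, t = 3 * K₃ := ⟨_, rfl⟩
  obtain ⟨K₂', hK₂'⟩ : ∃ t : ℤ, t = 2 * E.b₂ := ⟨_, rfl⟩
  set F : ℤ[X] := C K₃ * X ^ 3 + C E.b₂ * X ^ 2 + C K₁ * X + C E.b₆ with hF
  set a : ℤ_[ℓ] := ⟨s, ns⟩ with ha
  have hacoe : ((a : ℤ_[ℓ]) : ℚ_[ℓ]) = s := rfl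
  have hFa0 : F.aeval a = (K₃ : ℤ_[ℓ]) * a ^ 3 + (E.b₂ : ℤ_[ℓ]) * a ^ 2 + (K₁ : ℤ_[ℓ]) * a + (E.b₆ : ℤ_[ℓ]) := by
    simp [hF]
  have hFa : ((F.aeval a : ℤ_[ℓ]) : ℚ_[ℓ]) = 4 * s ^ 3 + B₂ * s ^ 2 + 2 * B₄ * s + B₆ := by
    rw [hFa0]; push_cast; rw [hacoe, hK₃, hK₁]; push_cast; rw [hB₂, hB₄, hB₆]
  have hF' : F.derivative = C K₃' * X ^ 2 + C K₂' * X + C K₁ := by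
    simp only [hF, derivative_add, derivative_mul, derivative_C, derivative_X_pow, derivative_X, zero_mul, zero_add,
      mul_one, hK₃', hK₂', map_mul]
    norm_num
    ring
  have hFa'0 : F.derivative.aeval a = (K₃' : ℤ_[ℓ]) * a ^ 2 + (K₂' : ℤ_[ℓ]) * a + (K₁ : ℤ_[ℓ]) := by
    rw [hF']; simp
  have hFa' : ((F.derivative.aeval a : ℤ_[ℓ]) : ℚ_[ℓ]) = 12 * s ^ 2 + 2 * B₂ * s + 2 * B₄ := by
    rw [hFa'0]; push_cast; rw [hacoe, hK₃', hK₂', hK₁, hK₃]; push_cast; rw [hB₂, hB₄]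
  have nFa : ‖F.aeval a‖ < 1 := by
    rw [← PadicInt.padic_norm_e_of_padicInt, hFa, hFs, norm_div, norm_mul, norm_mul, norm_pow, nc4, one_pow, div_one]
    have h32 : ‖(-32 : ℚ_[ℓ])‖ ≤ 1 := by
      have : ‖((-32 : ℤ) : ℚ_[ℓ])‖ ≤ 1 := Padic.norm_int_le_one _
      push_cast at this; exact this
    calc ‖(-32 : ℚ_[ℓ])‖ * ‖Δ‖ * ‖c6‖ ≤ 1 * ‖Δ‖ * 1 := by gcongr
      _ = ‖Δ‖ := by ring
      _ < 1 := nΔ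
  have nFa' : ‖F.derivative.aeval a‖ = 1 := by
    rw [← PadicInt.padic_norm_e_of_padicInt, hFa']
    have h1 : ‖c4 / 4‖ = 1 := by rw [norm_div, nc4, n4, div_one]
    have h2 : ‖-(576 * Δ / c4 ^ 2)‖ < 1 := by
      rw [norm_neg, norm_div, norm_mul, norm_pow, nc4, one_pow, div_one]
      have h576 : ‖(576 : ℚ_[ℓ])‖ ≤ 1 := by
        have : ‖((576 : ℤ) : ℚ_[ℓ])‖ ≤ 1 := Padic.norm_int_le_one _
        push_cast at this; exact this
      calc ‖(576 : ℚ_[ℓ])‖ * ‖Δ‖ ≤ 1 * ‖Δ‖ := by gcongr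
        _ < 1 := by rw [one_mul]; exact nΔ
    have hne : ‖c4 / 4‖ ≠ ‖-(576 * Δ / c4 ^ 2)‖ := by rw [h1]; exact (ne_of_lt h2).symm
    rw [hF's, Padic.add_eq_max_of_ne hne, h1]
    exact max_eq_left h2.le
  have hnorm : ‖F.aeval a‖ < ‖F.derivative.aeval a‖ ^ 2 := by rw [nFa', one_pow]; exact nFa
  obtain ⟨z, hz, -⟩ := hensels_lemma hnorm
  refine ⟨(z : ℚ_[ℓ]), ?_⟩
  have hz0 : F.aeval z = (K₃ : ℤ_[ℓ]) * z ^ 3 + (E.b₂ : ℤ_[ℓ]) * z ^ 2 + (K₁ : ℤ_[ℓ]) * z + (E.b₆ : ℤ_[ℓ]) := by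
    simp [hF]
  rw [hz0] at hz
  have hz' := congrArg ((↑) : ℤ_[ℓ] → ℚ_[ℓ]) hz
  push_cast at hz'
  rw [hK₃, hK₁] at hz'
  push_cast at hz'
  rw [eb₂, eb₄, eb₆, hB₂, hB₄, hB₆]
  linear_combination hz'

/-! ## §3. The dichotomy at an odd multiplicative prime, and the `Δ ∈ ℚ×²` strata -/

/-- **At an odd multiplicative prime: `3` roots in `ℚ_ℓ` iff `Δ` is an `ℓ`-adic square.** [folklore] -/
theorem card_roots_twoTorsionPolynomial_padic_eq_three_iff_of_mult_odd {ℓ : ℕ} [Fact ℓ.Prime] (hℓ : ℓ ≠ 2)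
    (hm : Mult W ℓ) :
    Multiset.card ((W.twoTorsionPolynomial.toPoly).map (algebraMap ℚ ℚ_[ℓ])).roots = 3 ↔
      IsSquare ((W.Δ : ℚ) : ℚ_[ℓ]) := by
  obtain ⟨r, hr⟩ := exists_padic_root_twoDivisionCubic_of_mult_odd W hℓ hm
  exact card_roots_twoTorsionPolynomial_eq_three_iff_of_root W
    (by simpa using hr)

/-- **At an odd multiplicative prime: exactly `1` root in `ℚ_ℓ` when `Δ` is not an `ℓ`-adic square.** [folklore] -/
theorem card_roots_twoTorsionPolynomial_padic_eq_one_of_mult_odd_of_not_isSquare {ℓ : ℕ} [Fact ℓ.Prime] (hℓ : ℓ ≠ 2)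
    (hm : Mult W ℓ) (hΔ : ¬ IsSquare ((W.Δ : ℚ) : ℚ_[ℓ])) :
    Multiset.card ((W.twoTorsionPolynomial.toPoly).map (algebraMap ℚ ℚ_[ℓ])).roots = 1 := by
  obtain ⟨r, hr⟩ := exists_padic_root_twoDivisionCubic_of_mult_odd W hℓ hm
  exact card_roots_twoTorsionPolynomial_eq_one_of_root_of_not_isSquare W (by simpa using hr) hΔ

/-- **At an odd multiplicative prime the `2`-division cubic has `1` or `3` roots in `ℚ_ℓ`** (never `0` or `2`): `ℓ` is never inert
in the cubic field of a `2`-torsion point. [folklore] -/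
theorem card_roots_twoTorsionPolynomial_padic_eq_one_or_three_of_mult_odd {ℓ : ℕ} [Fact ℓ.Prime] (hℓ : ℓ ≠ 2)
    (hm : Mult W ℓ) :
    Multiset.card ((W.twoTorsionPolynomial.toPoly).map (algebraMap ℚ ℚ_[ℓ])).roots = 1 ∨
      Multiset.card ((W.twoTorsionPolynomial.toPoly).map (algebraMap ℚ ℚ_[ℓ])).roots = 3 := by
  by_cases hΔ : IsSquare ((W.Δ : ℚ) : ℚ_[ℓ])
  · exact Or.inr ((card_roots_twoTorsionPolynomial_padic_eq_three_iff_of_mult_odd W hℓ hm).mpr hΔ)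
  · exact Or.inl (card_roots_twoTorsionPolynomial_padic_eq_one_of_mult_odd_of_not_isSquare W hℓ hm hΔ)

/-- **On the strata with `Δ_W ∈ ℚ×²` (cubic mod-`2` image (γ₁); full rational `2`-torsion) EVERY multiplicative prime `ℓ` splits
completely in `ℚ(E[2])`: `ψ₂²` has `3` roots in `ℚ_ℓ`** — odd `ℓ` by §2, `ℓ = 2` by GEN 21's Hensel root at `a₁` odd
(`card_roots_twoTorsionPolynomial_padic_two_of_goodOrd_or_mult_of_isSquare`). Card `f4-semisimple-cubic-two` §(1).
[folklore] -/
theorem card_roots_twoTorsionPolynomial_padic_eq_three_of_mult_of_isSquare {ℓ : ℕ} [Fact ℓ.Prime] (hm : Mult W ℓ)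
    (hΔ : IsSquare W.Δ) :
    Multiset.card ((W.twoTorsionPolynomial.toPoly).map (algebraMap ℚ ℚ_[ℓ])).roots = 3 := by
  by_cases hℓ : ℓ = 2
  · subst hℓ
    exact card_roots_twoTorsionPolynomial_padic_two_of_goodOrd_or_mult_of_isSquare W (Or.inr hm) hΔ
  · obtain ⟨r, hr⟩ := exists_padic_root_twoDivisionCubic_of_mult_odd W hℓ hm
    refine card_roots_twoTorsionPolynomial_eq_three_of_root_of_isSquare W (by simpa using hr) ?_
    obtain ⟨v, hv⟩ := hΔ
    exact ⟨(v : ℚ_[ℓ]), by rw [hv]; push_cast; ring⟩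

end Summit.BirchSwinnertonDyer.BirchSwinnertonDyer.Theorems.TwoAdicTwistConverse

end
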